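import Mathlib
import Summits.AnomalousDissipation.AnomalousDissipation.Theorems.DyadicWallCascadeDyadicRealisationZeroStressTools
import HarnessLib

/-!
# Momentum tools for the rate obstruction `NoFastBlowDown` (Tools C1)

Tools file C1 of the unconditional rate obstruction `NoFastBlowDown` for the witnesses of the crux
`Summit.AnomalousDissipation.AnomalousDissipation.Theses.DyadicWallCascade.ViscousContinuation`
(stmt-AnomalousDissipation-17917, line SketchIdeator4, lead c1).

For a bounded smooth steady Navier–Stokes pair `(W, P)` on `ℝ³` (unit viscosity, no force) the
momentum equation of the rescaled solution `(λW(λ·), λ²P(λ·))`, tested against `φ eᵢ` with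
`φ ∈ C²_c` and divided by `λ²`, reads `T1(λ) + T2(λ) = -λ⁻¹ L(λ)` with
`T1 = ∫ Wᵢ(λY) (Dφ(Y)·W(λY))`, `T2 = ∫ P(λY) ∂ᵢφ(Y)`, `L = ∫ Δφ(Y) Wᵢ(λY)`.  This file supplies:

* `noFastBlowDown_momentum_identity` — the identity above with the EXACT Laplacian term (the
  equality `key` inside the tree lemma `zeroStress_momentum_scaled`);
* `noFastBlowDown_momentum_convective_diff` — `|T1(W(λ·)) - T1(V)| ≤ δ (C' + C) ∫ ‖Dφ‖` when
  `|W| ≤ C'`, `|V| ≤ C` and `|W(λ·) - V| ≤ δ` on `tsupport φ`;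
* `noFastBlowDown_momentum_pressure_diff` — `|T2(P(λ·)) - T2(Q)| ≤ δ ∫ ‖Dφ‖` when
  `|P(λ·) - Q| ≤ δ` on `tsupport φ`;
* `noFastBlowDown_momentum_laplacian_diff` — `|L(W(λ·)) - L(V)| ≤ δ ∫ |Δφ|` when
  `|W(λ·) - V| ≤ δ` on `tsupport φ`;
* `noFastBlowDown_momentum_laplacian_bound` — `|L(W(λ·))| ≤ C' ∫ |Δφ|` when `|W| ≤ C'`.

All statements are folklore; the file ends with the registered tools stub
`stub_noFastBlowDownMomentumTools` (conjunction of the five statements).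
-/

open MeasureTheory Set Filter Topology Function
open Literature.Analysis.FluidPDE
open scoped BigOperators Laplacian RealInnerProductSpace

set_option linter.dupNamespace false

noncomputable section

namespace Summit.AnomalousDissipation.AnomalousDissipation.Theorems

/-! ## The tested momentum identity of the rescaled solution -/

/-- **Scaled tested momentum identity, exact form.**  For a bounded smooth solution `(W, P)` of
the clause-form steady Navier–Stokes system on `ℝ³` (unit viscosity, no force), a test function
`φ ∈ C²_c`, a coordinate direction `eᵢ` and `λ > 0`,
`∫ W_i(λY) (Dφ(Y)·W(λY)) dY + ∫ P(λY) ∂ᵢφ(Y) dY = -λ⁻¹ ∫ (Δφ)(Y) W_i(λY) dY`: the tested momentum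
identity `zeroStress_momentum_identity` for the rescaled solution `(λW(λ·), λ²P(λ·))`
(`Tsai2021.isLerayProfile_scale`), divided by `λ²`. [folklore] -/
theorem noFastBlowDown_momentum_identity
    (W : EuclideanSpace ℝ (Fin 3) → EuclideanSpace ℝ (Fin 3)) (P : EuclideanSpace ℝ (Fin 3) → ℝ)
    (φ : EuclideanSpace ℝ (Fin 3) → ℝ) (i : Fin 3)
    (hW : ContDiff ℝ ((⊤ : ℕ∞) : WithTop ℕ∞) W) (hP : ContDiff ℝ ((⊤ : ℕ∞) : WithTop ℕ∞) P)
    (hdiv : ∀ X : EuclideanSpace ℝ (Fin 3),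
      ∑ i : Fin 3, (fderiv ℝ W X (EuclideanSpace.single i (1 : ℝ))) i = 0)
    (hNS : ∀ X : EuclideanSpace ℝ (Fin 3), (fderiv ℝ W X) (W X) + gradient P X =
      ∑ i : Fin 3, fderiv ℝ (fun Y => fderiv ℝ W Y (EuclideanSpace.single i (1 : ℝ))) X
        (EuclideanSpace.single i (1 : ℝ)))
    (hφ : ContDiff ℝ 2 φ) (hφc : HasCompactSupport φ) (lam : ℝ) (hlam : 0 < lam) :
    (∫ Y, (W (lam • Y)) i * fderiv ℝ φ Y (W (lam • Y))) +
        ∫ Y, P (lam • Y) * fderiv ℝ φ Y (EuclideanSpace.single i (1 : ℝ)) =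
      -(lam⁻¹ * ∫ Y, (Δ φ) Y * (W (lam • Y)) i) := by
  -- adapted from `zeroStress_momentum_scaled` (tree, ZeroStressTools), stopping at `key`
  have hprof : IsLerayProfile 1 0 W P := fluxSign_isLerayProfile hW hP hdiv hNS
  set a : EuclideanSpace ℝ (Fin 3) := EuclideanSpace.single i (1 : ℝ) with ha
  have hinner : ∀ v : EuclideanSpace ℝ (Fin 3), ⟪v, a⟫ = v i := fun v => by
    rw [ha, EuclideanSpace.inner_single_right]; simp
  -- the identity for the rescaled solution
  have hl := Tsai2021.isLerayProfile_scale hprof hlam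
  have hid := zeroStress_momentum_identity hl hφ hφc a
  have e1 : ∫ x, ⟪lam • W (lam • x), a⟫ * fderiv ℝ φ x (lam • W (lam • x)) =
      lam ^ 2 * ∫ x, (W (lam • x)) i * fderiv ℝ φ x (W (lam • x)) := by
    rw [← integral_const_mul]
    refine integral_congr_ae (Eventually.of_forall fun x => ?_)
    simp only
    rw [hinner, map_smul, PiLp.smul_apply, smul_eq_mul, smul_eq_mul]; ring
  have e2 : ∫ x, lam ^ 2 * P (lam • x) * fderiv ℝ φ x a =
      lam ^ 2 * ∫ x, P (lam • x) * fderiv ℝ φ x a := by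
    rw [← integral_const_mul]
    refine integral_congr_ae (Eventually.of_forall fun x => ?_)
    simp only
    ring
  have e3 : ∫ x, (Δ φ) x * ⟪lam • W (lam • x), a⟫ = lam * ∫ x, (Δ φ) x * (W (lam • x)) i := by
    rw [← integral_const_mul]
    refine integral_congr_ae (Eventually.of_forall fun x => ?_)
    simp only
    rw [hinner, PiLp.smul_apply, smul_eq_mul]; ring
  rw [e1, e2, e3] at hid
  -- divide by `λ²`
  have hlam0 : lam ≠ 0 := hlam.ne'
  set T1 : ℝ := ∫ x, (W (lam • x)) i * fderiv ℝ φ x (W (lam • x)) with hT1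
  set T2 : ℝ := ∫ x, P (lam • x) * fderiv ℝ φ x a with hT2
  set L : ℝ := ∫ x, (Δ φ) x * (W (lam • x)) i with hL
  have h1 : lam * (lam * (T1 + T2) + L) = 0 := by linear_combination hid
  have h3 : lam * (T1 + T2) + L = 0 := by
    rcases mul_eq_zero.1 h1 with h | h
    · exact absurd h hlam0
    · exact h
  calc T1 + T2 = lam⁻¹ * (lam * (T1 + T2)) := by
        rw [← mul_assoc, inv_mul_cancel₀ hlam0, one_mul]
    _ = -(lam⁻¹ * L) := by rw [show lam * (T1 + T2) = -L by linarith]; ring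

/-! ## Difference estimates -/

/-- **Lipschitz estimate for the convective term.**  If `|W| ≤ C'` everywhere, `|V| ≤ C` and
`|W(λ·) - V| ≤ δ` on `tsupport φ` (`φ ∈ C¹_c`), then
`|∫ W_i(λY) (Dφ(Y)·W(λY)) - ∫ V_i(Y) (Dφ(Y)·V(Y))| ≤ δ (C' + C) ∫ ‖Dφ‖`: pointwise
`w_i Dφ·w - v_i Dφ·v = (w_i - v_i) Dφ·w + v_i Dφ·(w - v)`, and both integrands vanish off
`tsupport φ`. [folklore] -/
theorem noFastBlowDown_momentum_convective_diff
    (W V : EuclideanSpace ℝ (Fin 3) → EuclideanSpace ℝ (Fin 3)) (φ : EuclideanSpace ℝ (Fin 3) → ℝ)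
    (C C' δ lam : ℝ) (i : Fin 3) (hW : Continuous W) (hV : Continuous V) (hφ : ContDiff ℝ 1 φ)
    (hφc : HasCompactSupport φ) (hWb : ∀ X, ‖W X‖ ≤ C') (hVb : ∀ Y ∈ tsupport φ, ‖V Y‖ ≤ C)
    (hδ : 0 ≤ δ) (hWV : ∀ Y ∈ tsupport φ, ‖W (lam • Y) - V Y‖ ≤ δ) :
    |(∫ Y, (W (lam • Y)) i * fderiv ℝ φ Y (W (lam • Y))) -
        ∫ Y, (V Y) i * fderiv ℝ φ Y (V Y)| ≤ δ * ((C' + C) * ∫ Y, ‖fderiv ℝ φ Y‖) := by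
  have hDφc : Continuous (fderiv ℝ φ) := hφ.continuous_fderiv one_ne_zero
  have hDφcs : HasCompactSupport (fderiv ℝ φ) := hφc.fderiv (𝕜 := ℝ)
  have hWl : Continuous fun Y : EuclideanSpace ℝ (Fin 3) => W (lam • Y) :=
    hW.comp (continuous_const_smul lam)
  have hcs : ∀ v : EuclideanSpace ℝ (Fin 3) → EuclideanSpace ℝ (Fin 3),
      HasCompactSupport fun Y => (v Y) i * fderiv ℝ φ Y (v Y) := fun v =>
    hDφcs.mono fun x hx => by
      rw [mem_support] at hx ⊢
      contrapose! hx
      simp [hx]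
  have hI1 : Integrable fun Y => (W (lam • Y)) i * fderiv ℝ φ Y (W (lam • Y)) :=
    (((PiLp.continuous_apply 2 _ i).comp hWl).mul (hDφc.clm_apply hWl))
      |>.integrable_of_hasCompactSupport (hcs _)
  have hI2 : Integrable fun Y => (V Y) i * fderiv ℝ φ Y (V Y) :=
    (((PiLp.continuous_apply 2 _ i).comp hV).mul (hDφc.clm_apply hV))
      |>.integrable_of_hasCompactSupport (hcs V)
  have hI3 : Integrable fun Y => δ * ((C' + C) * ‖fderiv ℝ φ Y‖) :=
    (continuous_const.mul (continuous_const.mul hDφc.norm)).integrable_of_hasCompactSupport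
      (hDφcs.norm.mul_left).mul_left
  rw [← integral_sub hI1 hI2, ← integral_const_mul, ← integral_const_mul]
  refine (Real.norm_eq_abs _).symm.le.trans (norm_integral_le_of_norm_le hI3
    (Eventually.of_forall fun Y => ?_))
  rw [Real.norm_eq_abs]
  by_cases hY : Y ∈ tsupport φ
  · have hwv : ‖W (lam • Y) - V Y‖ ≤ δ := hWV Y hY
    have hv : ‖V Y‖ ≤ C := hVb Y hY
    have hC : 0 ≤ C := (norm_nonneg _).trans hv
    have h1 : |(W (lam • Y)) i - (V Y) i| ≤ δ := by
      have := PiLp.norm_apply_le (W (lam • Y) - V Y) i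
      simp only [PiLp.sub_apply, Real.norm_eq_abs] at this
      exact this.trans hwv
    have h2 : |fderiv ℝ φ Y (W (lam • Y))| ≤ ‖fderiv ℝ φ Y‖ * C' := by
      have := (fderiv ℝ φ Y).le_opNorm (W (lam • Y))
      rw [Real.norm_eq_abs] at this
      exact this.trans (mul_le_mul_of_nonneg_left (hWb _) (norm_nonneg _))
    have h3 : |(V Y) i| ≤ C := by
      have := PiLp.norm_apply_le (V Y) i
      rw [Real.norm_eq_abs] at this
      exact this.trans hv
    have h4 : |fderiv ℝ φ Y (W (lam • Y) - V Y)| ≤ ‖fderiv ℝ φ Y‖ * δ := by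
      have := (fderiv ℝ φ Y).le_opNorm (W (lam • Y) - V Y)
      rw [Real.norm_eq_abs] at this
      exact this.trans (mul_le_mul_of_nonneg_left hwv (norm_nonneg _))
    have key : (W (lam • Y)) i * fderiv ℝ φ Y (W (lam • Y)) - (V Y) i * fderiv ℝ φ Y (V Y) =
        ((W (lam • Y)) i - (V Y) i) * fderiv ℝ φ Y (W (lam • Y)) +
          (V Y) i * fderiv ℝ φ Y (W (lam • Y) - V Y) := by
      rw [map_sub]; ring
    rw [key]
    calc |((W (lam • Y)) i - (V Y) i) * fderiv ℝ φ Y (W (lam • Y)) +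
            (V Y) i * fderiv ℝ φ Y (W (lam • Y) - V Y)|
        ≤ |((W (lam • Y)) i - (V Y) i) * fderiv ℝ φ Y (W (lam • Y))| +
            |(V Y) i * fderiv ℝ φ Y (W (lam • Y) - V Y)| := abs_add_le _ _
      _ = |(W (lam • Y)) i - (V Y) i| * |fderiv ℝ φ Y (W (lam • Y))| +
            |(V Y) i| * |fderiv ℝ φ Y (W (lam • Y) - V Y)| := by rw [abs_mul, abs_mul]
      _ ≤ δ * (‖fderiv ℝ φ Y‖ * C') + C * (‖fderiv ℝ φ Y‖ * δ) :=
          add_le_add (mul_le_mul h1 h2 (abs_nonneg _) hδ) (mul_le_mul h3 h4 (abs_nonneg _) hC)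
      _ = δ * ((C' + C) * ‖fderiv ℝ φ Y‖) := by ring
  · rw [fderiv_of_notMem_tsupport ℝ hY]
    simp

/-- **Lipschitz estimate for the pressure term.**  If `|P(λ·) - Q| ≤ δ` on `tsupport φ`
(`φ ∈ C¹_c`), then `|∫ P(λY) ∂ᵢφ(Y) - ∫ Q(Y) ∂ᵢφ(Y)| ≤ δ ∫ ‖Dφ‖` (`‖eᵢ‖ = 1`; both integrands
vanish off `tsupport φ`). [folklore] -/
theorem noFastBlowDown_momentum_pressure_diff
    (P Q : EuclideanSpace ℝ (Fin 3) → ℝ) (φ : EuclideanSpace ℝ (Fin 3) → ℝ) (δ lam : ℝ)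
    (i : Fin 3) (hP : Continuous P) (hQ : Continuous Q) (hφ : ContDiff ℝ 1 φ)
    (hφc : HasCompactSupport φ) (hδ : 0 ≤ δ) (hPQ : ∀ Y ∈ tsupport φ, |P (lam • Y) - Q Y| ≤ δ) :
    |(∫ Y, P (lam • Y) * fderiv ℝ φ Y (EuclideanSpace.single i (1 : ℝ))) -
        ∫ Y, Q Y * fderiv ℝ φ Y (EuclideanSpace.single i (1 : ℝ))| ≤
      δ * ∫ Y, ‖fderiv ℝ φ Y‖ := by
  have hDφc : Continuous (fderiv ℝ φ) := hφ.continuous_fderiv one_ne_zero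
  have hDφcs : HasCompactSupport (fderiv ℝ φ) := hφc.fderiv (𝕜 := ℝ)
  have hcs : ∀ f : EuclideanSpace ℝ (Fin 3) → ℝ,
      HasCompactSupport fun Y => f Y * fderiv ℝ φ Y (EuclideanSpace.single i (1 : ℝ)) := fun f =>
    hDφcs.mono fun x hx => by
      rw [mem_support] at hx ⊢
      contrapose! hx
      simp [hx]
  have hPl : Continuous fun Y : EuclideanSpace ℝ (Fin 3) => P (lam • Y) :=
    hP.comp (continuous_const_smul lam)
  have hI1 : Integrable fun Y => P (lam • Y) * fderiv ℝ φ Y (EuclideanSpace.single i (1 : ℝ)) :=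
    (hPl.mul (hDφc.clm_apply continuous_const)).integrable_of_hasCompactSupport (hcs _)
  have hI2 : Integrable fun Y => Q Y * fderiv ℝ φ Y (EuclideanSpace.single i (1 : ℝ)) :=
    (hQ.mul (hDφc.clm_apply continuous_const)).integrable_of_hasCompactSupport (hcs Q)
  have hI3 : Integrable fun Y => δ * ‖fderiv ℝ φ Y‖ :=
    (continuous_const.mul hDφc.norm).integrable_of_hasCompactSupport hDφcs.norm.mul_left
  rw [← integral_sub hI1 hI2, ← integral_const_mul]
  refine (Real.norm_eq_abs _).symm.le.trans (norm_integral_le_of_norm_le hI3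
    (Eventually.of_forall fun Y => ?_))
  rw [Real.norm_eq_abs, ← sub_mul, abs_mul]
  by_cases hY : Y ∈ tsupport φ
  · refine mul_le_mul (hPQ Y hY) ?_ (abs_nonneg _) hδ
    have := (fderiv ℝ φ Y).le_opNorm (EuclideanSpace.single i (1 : ℝ))
    rw [PiLp.norm_single, norm_one, mul_one, Real.norm_eq_abs] at this
    exact this
  · rw [fderiv_of_notMem_tsupport ℝ hY]
    simp

/-- **Lipschitz estimate for the Laplacian term.**  If `|W(λ·) - V| ≤ δ` on `tsupport φ`
(`φ ∈ C²_c`), then `|∫ (Δφ) W_i(λ·) - ∫ (Δφ) V_i| ≤ δ ∫ |Δφ|` (`Δφ` vanishes off `tsupport φ`).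
[folklore] -/
theorem noFastBlowDown_momentum_laplacian_diff
    (W V : EuclideanSpace ℝ (Fin 3) → EuclideanSpace ℝ (Fin 3)) (φ : EuclideanSpace ℝ (Fin 3) → ℝ)
    (δ lam : ℝ) (i : Fin 3) (hW : Continuous W) (hV : Continuous V) (hφ : ContDiff ℝ 2 φ)
    (hφc : HasCompactSupport φ) (_hδ : 0 ≤ δ) (hWV : ∀ Y ∈ tsupport φ, ‖W (lam • Y) - V Y‖ ≤ δ) :
    |(∫ Y, (Δ φ) Y * (W (lam • Y)) i) - ∫ Y, (Δ φ) Y * (V Y) i| ≤ δ * ∫ Y, |(Δ φ) Y| := by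
  have hΔφc : Continuous (Δ φ) := continuous_laplacian hφ
  have hΔφcs : HasCompactSupport (Δ φ) := hφc.mono' fun x hx => by
    contrapose! hx; simp [laplacian_eq_zero_of_notMem_tsupport hx]
  have hWl : Continuous fun Y : EuclideanSpace ℝ (Fin 3) => W (lam • Y) :=
    hW.comp (continuous_const_smul lam)
  have hI1 : Integrable fun Y => (Δ φ) Y * (W (lam • Y)) i :=
    (hΔφc.mul ((PiLp.continuous_apply 2 _ i).comp hWl)).integrable_of_hasCompactSupport
      hΔφcs.mul_right
  have hI2 : Integrable fun Y => (Δ φ) Y * (V Y) i :=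
    (hΔφc.mul ((PiLp.continuous_apply 2 _ i).comp hV)).integrable_of_hasCompactSupport
      hΔφcs.mul_right
  have hI3 : Integrable fun Y => δ * |(Δ φ) Y| :=
    (continuous_const.mul (continuous_abs.comp hΔφc)).integrable_of_hasCompactSupport
      hΔφcs.abs.mul_left
  rw [← integral_sub hI1 hI2, ← integral_const_mul]
  refine (Real.norm_eq_abs _).symm.le.trans (norm_integral_le_of_norm_le hI3
    (Eventually.of_forall fun Y => ?_))
  rw [Real.norm_eq_abs, ← mul_sub]
  by_cases hY : Y ∈ tsupport φ
  · rw [abs_mul, mul_comm δ]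
    refine mul_le_mul_of_nonneg_left ?_ (abs_nonneg _)
    have := PiLp.norm_apply_le (W (lam • Y) - V Y) i
    simp only [PiLp.sub_apply, Real.norm_eq_abs] at this
    exact this.trans (hWV Y hY)
  · rw [laplacian_eq_zero_of_notMem_tsupport hY]
    simp

/-- **Bound for the Laplacian term.**  If `|W| ≤ C'` everywhere and `φ ∈ C²_c`, then
`|∫ (Δφ)(Y) W_i(λY) dY| ≤ C' ∫ |Δφ|` (the bound `hA` inside `zeroStress_momentum_scaled`).
[folklore] -/
theorem noFastBlowDown_momentum_laplacian_bound
    (W : EuclideanSpace ℝ (Fin 3) → EuclideanSpace ℝ (Fin 3)) (φ : EuclideanSpace ℝ (Fin 3) → ℝ)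
    (C' lam : ℝ) (i : Fin 3) (_hW : Continuous W) (hφ : ContDiff ℝ 2 φ)
    (hφc : HasCompactSupport φ) (hWb : ∀ X, ‖W X‖ ≤ C') :
    |∫ Y, (Δ φ) Y * (W (lam • Y)) i| ≤ C' * ∫ Y, |(Δ φ) Y| := by
  -- adapted from the bound `hA` in `zeroStress_momentum_scaled` (tree, ZeroStressTools)
  have hΔφc : Continuous (Δ φ) := continuous_laplacian hφ
  have hΔφcs : HasCompactSupport (Δ φ) := hφc.mono' fun x hx => by
    contrapose! hx; simp [laplacian_eq_zero_of_notMem_tsupport hx]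
  have hI1' : Integrable fun x => |(Δ φ) x| * C' :=
    ((continuous_abs.comp hΔφc).mul continuous_const).integrable_of_hasCompactSupport
      (hΔφcs.abs.mul_right)
  rw [← integral_const_mul]
  simp_rw [mul_comm C']
  refine (Real.norm_eq_abs _).symm.le.trans (norm_integral_le_of_norm_le hI1'
    (Eventually.of_forall fun x => ?_))
  rw [Real.norm_eq_abs, abs_mul]
  refine mul_le_mul_of_nonneg_left ?_ (abs_nonneg _)
  exact ((Real.norm_eq_abs _).symm.le.trans (PiLp.norm_apply_le (W (lam • x)) i)).trans (hWb _)

/-! ## The registered tools stub -/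

/-- Registered tools stub `stub_noFastBlowDownMomentumTools` of the rate obstruction
`NoFastBlowDown` (line SketchIdeator4 of crux `ViscousContinuation`): the conjunction of the five
lemmas of this file. [folklore] -/
theorem stub_noFastBlowDownMomentumTools :
    (∀ (W : EuclideanSpace ℝ (Fin 3) → EuclideanSpace ℝ (Fin 3)) (P : EuclideanSpace ℝ (Fin 3) → ℝ)
      (φ : EuclideanSpace ℝ (Fin 3) → ℝ) (i : Fin 3),
      ContDiff ℝ ((⊤ : ℕ∞) : WithTop ℕ∞) W → ContDiff ℝ ((⊤ : ℕ∞) : WithTop ℕ∞) P →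
      (∀ X : EuclideanSpace ℝ (Fin 3),
        ∑ i : Fin 3, (fderiv ℝ W X (EuclideanSpace.single i (1 : ℝ))) i = 0) →
      (∀ X : EuclideanSpace ℝ (Fin 3), (fderiv ℝ W X) (W X) + gradient P X =
        ∑ i : Fin 3, fderiv ℝ (fun Y => fderiv ℝ W Y (EuclideanSpace.single i (1 : ℝ))) X
          (EuclideanSpace.single i (1 : ℝ))) →
      ContDiff ℝ 2 φ → HasCompactSupport φ → ∀ lam : ℝ, 0 < lam →
      (∫ Y, (W (lam • Y)) i * fderiv ℝ φ Y (W (lam • Y))) +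
          ∫ Y, P (lam • Y) * fderiv ℝ φ Y (EuclideanSpace.single i (1 : ℝ)) =
        -(lam⁻¹ * ∫ Y, Laplacian.laplacian φ Y * (W (lam • Y)) i)) ∧
    (∀ (W V : EuclideanSpace ℝ (Fin 3) → EuclideanSpace ℝ (Fin 3)) (φ : EuclideanSpace ℝ (Fin 3) → ℝ)
      (C C' δ lam : ℝ) (i : Fin 3), Continuous W → Continuous V → ContDiff ℝ 1 φ →
      HasCompactSupport φ → (∀ X, ‖W X‖ ≤ C') → (∀ Y ∈ tsupport φ, ‖V Y‖ ≤ C) → 0 ≤ δ →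
      (∀ Y ∈ tsupport φ, ‖W (lam • Y) - V Y‖ ≤ δ) →
      |(∫ Y, (W (lam • Y)) i * fderiv ℝ φ Y (W (lam • Y))) -
          ∫ Y, (V Y) i * fderiv ℝ φ Y (V Y)| ≤ δ * ((C' + C) * ∫ Y, ‖fderiv ℝ φ Y‖)) ∧
    (∀ (P Q : EuclideanSpace ℝ (Fin 3) → ℝ) (φ : EuclideanSpace ℝ (Fin 3) → ℝ) (δ lam : ℝ)
      (i : Fin 3), Continuous P → Continuous Q → ContDiff ℝ 1 φ → HasCompactSupport φ → 0 ≤ δ →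
      (∀ Y ∈ tsupport φ, |P (lam • Y) - Q Y| ≤ δ) →
      |(∫ Y, P (lam • Y) * fderiv ℝ φ Y (EuclideanSpace.single i (1 : ℝ))) -
          ∫ Y, Q Y * fderiv ℝ φ Y (EuclideanSpace.single i (1 : ℝ))| ≤
        δ * ∫ Y, ‖fderiv ℝ φ Y‖) ∧
    (∀ (W V : EuclideanSpace ℝ (Fin 3) → EuclideanSpace ℝ (Fin 3)) (φ : EuclideanSpace ℝ (Fin 3) → ℝ)
      (δ lam : ℝ) (i : Fin 3), Continuous W → Continuous V → ContDiff ℝ 2 φ →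
      HasCompactSupport φ → 0 ≤ δ → (∀ Y ∈ tsupport φ, ‖W (lam • Y) - V Y‖ ≤ δ) →
      |(∫ Y, Laplacian.laplacian φ Y * (W (lam • Y)) i) -
          ∫ Y, Laplacian.laplacian φ Y * (V Y) i| ≤ δ * ∫ Y, |Laplacian.laplacian φ Y|) ∧
    (∀ (W : EuclideanSpace ℝ (Fin 3) → EuclideanSpace ℝ (Fin 3)) (φ : EuclideanSpace ℝ (Fin 3) → ℝ)
      (C' lam : ℝ) (i : Fin 3), Continuous W → ContDiff ℝ 2 φ → HasCompactSupport φ →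
      (∀ X, ‖W X‖ ≤ C') →
      |∫ Y, Laplacian.laplacian φ Y * (W (lam • Y)) i| ≤ C' * ∫ Y, |Laplacian.laplacian φ Y|) :=
  ⟨noFastBlowDown_momentum_identity, noFastBlowDown_momentum_convective_diff,
    noFastBlowDown_momentum_pressure_diff, noFastBlowDown_momentum_laplacian_diff,
    noFastBlowDown_momentum_laplacian_bound⟩

end Summit.AnomalousDissipation.AnomalousDissipation.Theorems

end
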